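import Mathlib.Analysis.SpecificLimits.Normed
import Literature.Analysis.FunctionSpaces.LorentzGas
import HarnessLib

/-!
# The linear Lorentz–Boltzmann equation: gain/loss splitting, the collision (Dyson) series,
# and the decomposition of the Gallavotti–Spohn theorem
(trunk T-KINETIC; topic MathematicalPhysics/KineticTheory; serves the named fact
`Literature.MathematicalPhysics.KineticTheory.gallavotti_spohn_lorentz` of
`Literature.MathematicalPhysics.KineticTheory.ShortRangePotentials`)

The Boltzmann–Grad limit of the Lorentz gas with Poisson scatterers (Gallavotti 1969/1972;
Spohn, Comm. Math. Phys. 60 (1978); restated as Thm. 2.1 of Bodineau–Gallagher–Saint-Raymond,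
Invent. Math. 203 (2016), arXiv:1305.3397v2) asserts that the annealed one-particle density of
the Lorentz gas converges to *the* solution of the linear Lorentz–Boltzmann equation
`∂ₜ f + v·∇ₓ f = σ L f`, `L = Kinetic.lorentzCollisionOp`. Gallavotti's proof (as reproduced in
F. Golse's lecture notes *Recent results on the periodic Lorentz gas*, §2 "The Lorentz gas in the
Boltzmann–Grad limit with a Poisson distribution of obstacles", Thm. 2.1 and its proof,
arXiv:0906.0191 numbering) is an expansion of the annealed density over the number of obstacles
met before time `t`; the terms
without recollisions converge, one by one, to the terms of the *Duhamel (collision) series* of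
the limiting equation written in gain/loss form,
`f(t, x, v) = e^{-σν(v)t} f₀(x - tv, v) + ∫₀ᵗ e^{-σν(v)(t-s)} σ (L⁺ f(s, x - (t-s)v, ·))(v) ds`,
`ν(v) = ∫_{S^{d-1}} (v·ω)₊ dω` the loss frequency and `L⁺` the gain operator, and the
pathological configurations (recollisions, overlapping double hits) carry a vanishing mass.

This file vendors the objects of that proof and splits the named fact
`Hilbert6.gallavotti_spohn_lorentz` into two named facts along the printed architecture:

* `Kinetic.lorentzGainOp`, `Kinetic.lorentzLossRate`: the gain operator
  `(L⁺ g)(v) = ∫ (v·ω)₊ g(v - 2(v·ω)ω) dω` and the loss frequency `ν(v) = ∫ (v·ω)₊ dω`, with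
  `L g = L⁺ g - ν g` (`Kinetic.lorentzCollisionOp_eq_gain_sub_loss`, under integrability).
* `Kinetic.lorentzSeriesTerm G σ f₀ n`: the `n`-collision term of the Duhamel series (defined by
  the recursion `u₀ = e^{-σνt} f₀(x - tv, v)`,
  `u_{n+1}(t, x, v) = ∫₀ᵗ e^{-σν(v)(t-s)} σ (L⁺ u_n(s, x - (t-s)v, ·))(v) ds`), and
  `Kinetic.lorentzSeriesSolution G σ f₀ = ∑ₙ uₙ`, on any geometry `G` (torus or whole space).
* `Kinetic.lorentzSeries_isMildSolution` (named fact F1, global well-posedness half): for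
  continuous bounded data `f₀ ≥ 0` on `ℝ^d × ℝ^d` and `σ ≥ 0` the series is, for every `T ≥ 0`,
  a mild solution of the linear Lorentz–Boltzmann equation in the sense of the accepted
  `Kinetic.IsMildLinearLorentzSolutionOn` (Spohn 1978 §3, the random flight semigroup;
  Gallavotti 1972; a routine Picard/Dyson-series fact, to be discharged in
  `LinearLorentzBoltzmannProofs`).
* `Hilbert6.gallavotti_lorentz_tendsto_series` (named fact F3, the core of the theorem): under
  the hypotheses of `Hilbert6.gallavotti_spohn_lorentz`, the annealed observable
  `Kinetic.lorentzExpectation (Λ k) f₀ t φ` converges to `∫ φ · (∑ₙ uₙ)(t)` for every `t ≥ 0`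
  and every bounded continuous `φ` (BGSR Thm. 2.1, forward/observable form, with the limit
  identified as the collision series as in Gallavotti's proof).

`Hilbert6.gallavotti_spohn_lorentz` follows from F1 and F3 by taking `f := ∑ₙ uₙ`
(`ShortRangePotentialsProofs`). The value of the series at `t = 0` is `f₀`
(`Kinetic.lorentzSeriesSolution_zero`, proved here).

## Design

* The loss frequency is the sphere integral `∫ (v·ω)₊ dω` against the accepted UNnormalised
  `Hilbert6.sphereMeasure` (so that `L = L⁺ - ν` literally); its closed form `|B^{d-1}| |v|` is
  not needed here and is left to the proofs.
* The series terms are defined for all `t ∈ ℝ` (interval integrals `∫ s in 0..t`); only `t ≥ 0`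
  is meaningful, negative times are harmless junk (`∫₀ᵗ = -∫ₜ⁰`).
* Positions live on an arbitrary accepted `Kinetic.Geometry d X` (`x - (t-s)v` is
  `G.translate x ((s - t) • v)`), velocities in `EuclideanSpace ℝ d`, as in
  `Kinetic.IsMildLinearLorentzSolutionOn`; the facts are stated on `Euclidean.geometry d`, which
  is what `gallavotti_spohn_lorentz` consumes.

## References

* G. Gallavotti, *Divergences and approach to equilibrium in the Lorentz and the wind-tree
  models*, Phys. Rev. 185 (1969) 308–322; *Rigorous theory of the Boltzmann equation in the
  Lorentz gas*, Nota interna 358, Istituto di Fisica, Roma (1972).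
* H. Spohn, *The Lorentz process converges to a random flight process*, Comm. Math. Phys. 60
  (1978) 277–290, Thms 1–2, §3.
* T. Bodineau, I. Gallagher, L. Saint-Raymond, *The Brownian motion as the limit of a
  deterministic system of hard-spheres*, Invent. Math. 203 (2016) 493–553, Thm. 2.1
  (arXiv:1305.3397v2 numbering).
* F. Golse, *Recent results on the periodic Lorentz gas*, in: Nonlinear Partial Differential
  Equations (Adv. Courses Math. CRM Barcelona), Birkhäuser (2012) 39–99, §2, Thm. 2.1 and its
  proof (arXiv:0906.0191 numbering; Gallavotti's argument: collision series, tube/collision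
  change of variables, recollision part of vanishing mass).
-/

open MeasureTheory Metric Real Set Filter Topology
open scoped InnerProductSpace ENNReal

namespace Literature.MathematicalPhysics.KineticTheory

noncomputable section

section Hilbert6

variable {E : Type*} [NormedAddCommGroup E] [InnerProductSpace ℝ E] [FiniteDimensional ℝ E]
  [MeasurableSpace E] [BorelSpace E]

/-- The accepted surface measure `Hilbert6.sphereMeasure = volume.toSphere` of the unit sphere is
finite (total mass `|S^{d-1}| = d |B^d|`, Mathlib's `Measure.toSphere_apply_univ`); recorded as an
instance so that bounded continuous integrands on the sphere are integrable. [folklore] -/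
instance sphereMeasure.instIsFiniteMeasure :
    IsFiniteMeasure (sphereMeasure : Measure (sphere (0 : E) 1)) := by
  unfold sphereMeasure; infer_instance

end Hilbert6

section Kinetic

/-! ## Gain operator and loss frequency -/

section Operators

variable {E : Type*} [NormedAddCommGroup E] [InnerProductSpace ℝ E] [FiniteDimensional ℝ E]
  [MeasurableSpace E] [BorelSpace E]

/-- The *gain part* of the linear Lorentz collision operator,
`(L⁺ g)(v) = ∫_{S^{d-1}} (v·ω)₊ g(v - 2 (v·ω) ω) dω` (unnormalised surface measure
`Hilbert6.sphereMeasure`): the rate at which velocity `v` is produced by specular reflection of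
the velocities `v' = v - 2(v·ω)ω` on a uniformly illuminated unit ball (Gallavotti 1969; Spohn
CMP 60 (1978) Thm 3, (4.2): the jump part `∫ dσ(ω) (ω·p) f(q, p')` of the generator of the
random flight process, here for hard obstacles). Bochner integral, junk value `0`.
[cite: Spohn1978, Thm 3, (4.2)] -/
def lorentzGainOp (g : E → ℝ) (v : E) : ℝ :=
  ∫ ω : sphere (0 : E) 1, max ⟪v, (ω : E)⟫_ℝ 0 * g (v - (2 * ⟪v, (ω : E)⟫_ℝ) • (ω : E))
    ∂KineticTheory.sphereMeasure

/-- The *loss frequency* (total scattering rate at velocity `v`) of the linear Lorentz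
collision operator, `ν(v) = ∫_{S^{d-1}} (v·ω)₊ dω` (`= |B^{d-1}| |v|`, the cross-section of the
unit ball swept at speed `|v|`; Spohn CMP 60 (1978) Thm 3, (4.2): the loss part
`-∫ dσ(ω) (ω·p) f(q, p)` of the generator of the random flight process).
[cite: Spohn1978, Thm 3, (4.2)] -/
def lorentzLossRate (v : E) : ℝ :=
  ∫ ω : sphere (0 : E) 1, max ⟪v, (ω : E)⟫_ℝ 0 ∂KineticTheory.sphereMeasure

/-- The loss frequency is nonnegative. [folklore] -/
theorem lorentzLossRate_nonneg (v : E) : 0 ≤ lorentzLossRate v :=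
  integral_nonneg fun _ => le_max_right _ _

variable (E) in
/-- The total mass `|S^{d-1}|` of the accepted surface measure `Hilbert6.sphereMeasure`, as a real
number (so that `ν(v) ≤ |S^{d-1}| |v|`, `lorentzLossRate_le` in the proofs file). [folklore] -/
def sphereMass : ℝ := (KineticTheory.sphereMeasure : Measure (sphere (0 : E) 1)).real univ

/-- The total mass of the sphere is nonnegative. [folklore] -/
theorem sphereMass_nonneg : 0 ≤ sphereMass E := measureReal_nonneg

/-- The speed-dependent rate `a(v) = σ |S^{d-1}| |v|` dominating the damping `σ ν(v)` and the
gain operator on the energy shell `|v|` (the constant in the factorial bound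
`|uₙ(t)| ≤ ‖f₀‖_∞ e^{aT} (a e^{aT} |t|)ⁿ / n!` of the collision series). [folklore] -/
def termRate (σ : ℝ) (v : E) : ℝ := σ * sphereMass E * ‖v‖

/-- `termRate` is nonnegative for `σ ≥ 0`. [folklore] -/
theorem termRate_nonneg {σ : ℝ} (hσ : 0 ≤ σ) (v : E) : 0 ≤ termRate σ v :=
  mul_nonneg (mul_nonneg hσ sphereMass_nonneg) (norm_nonneg _)

/-- The loss frequency vanishes at `v = 0`. [folklore] -/
@[simp]
theorem lorentzLossRate_zero : lorentzLossRate (0 : E) = 0 := by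
  simp [lorentzLossRate]

/-- The gain operator applied to a nonnegative function is nonnegative. [folklore] -/
theorem lorentzGainOp_nonneg {g : E → ℝ} (hg : ∀ w, 0 ≤ g w) (v : E) : 0 ≤ lorentzGainOp g v :=
  integral_nonneg fun _ => mul_nonneg (le_max_right _ _) (hg _)

/-- The gain operator of a constant is the constant times the loss frequency (so that
`L 1 = L⁺ 1 - ν = 0`, conservation of mass). [folklore] -/
theorem lorentzGainOp_const (a : ℝ) (v : E) :
    lorentzGainOp (fun _ : E => a) v = lorentzLossRate v * a := by
  simp only [lorentzGainOp, lorentzLossRate]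
  exact integral_mul_const a _

/-- **Gain/loss splitting** of the linear Lorentz operator: if `ω ↦ (v·ω)₊ g(v - 2(v·ω)ω)` is
integrable on the sphere at `v` (e.g. `g` continuous, or bounded and measurable), then
`(L g)(v) = (L⁺ g)(v) - ν(v) g(v)` (Spohn CMP 60 (1978) (4.2): generator of the random flight
process = jump part minus collision rate). [cite: Spohn1978, (4.2)] -/
theorem lorentzCollisionOp_eq_gain_sub_loss (g : E → ℝ) (v : E)
    (hg : Integrable (fun ω : sphere (0 : E) 1 =>
      max ⟪v, (ω : E)⟫_ℝ 0 * g (v - (2 * ⟪v, (ω : E)⟫_ℝ) • (ω : E))) KineticTheory.sphereMeasure) :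
    Literature.Analysis.FunctionSpaces.lorentzCollisionOp g v = lorentzGainOp g v - lorentzLossRate v * g v := by
  have hl : Integrable (fun ω : sphere (0 : E) 1 => max ⟪v, (ω : E)⟫_ℝ 0 * g v)
      KineticTheory.sphereMeasure :=
    ((continuous_const.inner continuous_subtype_val).max
      continuous_const).integrable_of_hasCompactSupport (HasCompactSupport.of_compactSpace _)
      |>.mul_const _
  simp only [Literature.Analysis.FunctionSpaces.lorentzCollisionOp, lorentzGainOp, lorentzLossRate, mul_sub]
  rw [integral_sub hg hl, integral_mul_const]

end Operators

/-! ## The collision (Duhamel, Dyson) series of the linear Lorentz–Boltzmann equation -/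

section Series

variable {d : Type*} [Fintype d] {X : Type*}

/-- The `n`-collision term `uₙ` of the Duhamel series of the linear Lorentz–Boltzmann equation
`∂ₜ f + v·∇ₓ f = σ (L⁺ f - ν f)` on the geometry `G`, by recursion on `n`:
`u₀(t, x, v) = e^{-σ ν(v) t} f₀(x - t v, v)` (free flight damped by the loss frequency) and
`u_{n+1}(t, x, v) = ∫₀ᵗ e^{-σ ν(v) (t - s)} σ (L⁺ uₙ(s, x - (t - s) v, ·))(v) ds`
(last collision at time `s`, then damped free flight). This is the `n`-th term of the series
to which the `n`-obstacle, recollision-free part of the annealed Lorentz-gas density converges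
in Gallavotti's proof (Gallavotti 1972; Golse, *Recent results on the periodic Lorentz gas*,
proof of Thm. 2.1; Spohn CMP 60 (1978) §3, proof of Thm 2: the Dyson expansion
`U_t = Σ_k ∫ dt₁⋯dt_k S(t-t₁) C ⋯ C S(t_k)` of the limiting semigroup `e^{(L+C)t}`). Interval
integral in `s`, so all `t ∈ ℝ` are allowed (only `t ≥ 0` is meaningful).
[cite: Spohn1978, §3, proof of Thm 2] -/
def lorentzSeriesTerm (G : Literature.Analysis.FluidPDE.Geometry d X) (σ : ℝ) (f₀ : X → EuclideanSpace ℝ d → ℝ) :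
    ℕ → ℝ → X → EuclideanSpace ℝ d → ℝ
  | 0 => fun t x v => exp (-(σ * lorentzLossRate v * t)) * f₀ (G.translate x ((-t) • v)) v
  | n + 1 => fun t x v => ∫ s in (0 : ℝ)..t, exp (-(σ * lorentzLossRate v * (t - s))) *
      (σ * lorentzGainOp (lorentzSeriesTerm G σ f₀ n s (G.translate x ((s - t) • v))) v)

/-- The *collision (Duhamel) series* `f = ∑ₙ uₙ` of the linear Lorentz–Boltzmann equation with
coefficient `σ` and initial datum `f₀` on the geometry `G` — the candidate (and, by
`lorentzSeries_isMildSolution`, actual) global mild solution, i.e. the one-time marginal density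
of Spohn's random flight process started from `f₀` (Spohn CMP 60 (1978) §3, proof of Thm 2,
and Thm 3; Gallavotti 1972). Unconditional sum `tsum`, junk value `0` where not summable.
[cite: Spohn1978, §3, proof of Thm 2] -/
def lorentzSeriesSolution (G : Literature.Analysis.FluidPDE.Geometry d X) (σ : ℝ) (f₀ : X → EuclideanSpace ℝ d → ℝ)
    (t : ℝ) (x : X) (v : EuclideanSpace ℝ d) : ℝ :=
  ∑' n, lorentzSeriesTerm G σ f₀ n t x v

variable (G : Literature.Analysis.FluidPDE.Geometry d X) (σ : ℝ) (f₀ : X → EuclideanSpace ℝ d → ℝ)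

/-- Unfolding the free-flight term `u₀(t, x, v) = e^{-σν(v)t} f₀(x - tv, v)`. [folklore] -/
@[simp]
theorem lorentzSeriesTerm_zero (t : ℝ) (x : X) (v : EuclideanSpace ℝ d) :
    lorentzSeriesTerm G σ f₀ 0 t x v =
      exp (-(σ * lorentzLossRate v * t)) * f₀ (G.translate x ((-t) • v)) v := rfl

/-- Unfolding the recursion
`u_{n+1}(t, x, v) = ∫₀ᵗ e^{-σν(v)(t-s)} σ (L⁺ uₙ(s, x - (t-s)v, ·))(v) ds`. [folklore] -/
theorem lorentzSeriesTerm_succ (n : ℕ) (t : ℝ) (x : X) (v : EuclideanSpace ℝ d) :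
    lorentzSeriesTerm G σ f₀ (n + 1) t x v =
      ∫ s in (0 : ℝ)..t, exp (-(σ * lorentzLossRate v * (t - s))) *
        (σ * lorentzGainOp (lorentzSeriesTerm G σ f₀ n s (G.translate x ((s - t) • v))) v) :=
  rfl

/-- At time `0` the free-flight term is the datum. [folklore] -/
@[simp]
theorem lorentzSeriesTerm_zero_zero (x : X) (v : EuclideanSpace ℝ d) :
    lorentzSeriesTerm G σ f₀ 0 0 x v = f₀ x v := by
  simp [lorentzSeriesTerm_zero]

/-- At time `0` the terms with at least one collision vanish. [folklore] -/
@[simp]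
theorem lorentzSeriesTerm_succ_zero (n : ℕ) (x : X) (v : EuclideanSpace ℝ d) :
    lorentzSeriesTerm G σ f₀ (n + 1) 0 x v = 0 := by
  simp [lorentzSeriesTerm_succ]

/-- Unfolding lemma for the collision series. [folklore] -/
theorem lorentzSeriesSolution_apply (t : ℝ) (x : X) (v : EuclideanSpace ℝ d) :
    lorentzSeriesSolution G σ f₀ t x v = ∑' n, lorentzSeriesTerm G σ f₀ n t x v := rfl

/-- **Initial condition of the collision series**: `(∑ₙ uₙ)(0) = f₀` (only the free-flight term
survives at `t = 0`). [folklore] -/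
@[simp]
theorem lorentzSeriesSolution_zero : lorentzSeriesSolution G σ f₀ 0 = f₀ := by
  funext x v
  rw [lorentzSeriesSolution_apply, tsum_eq_single 0]
  · exact lorentzSeriesTerm_zero_zero G σ f₀ x v
  · intro n hn
    obtain ⟨m, rfl⟩ := Nat.exists_eq_succ_of_ne_zero hn
    exact lorentzSeriesTerm_succ_zero G σ f₀ m x v

/-- Without scatterers (`σ = 0`) the terms with at least one collision vanish. [folklore] -/
@[simp]
theorem lorentzSeriesTerm_succ_of_coeff_zero (n : ℕ) (t : ℝ) (x : X) (v : EuclideanSpace ℝ d) :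
    lorentzSeriesTerm G 0 f₀ (n + 1) t x v = 0 := by
  simp [lorentzSeriesTerm_succ]

/-- Without scatterers (`σ = 0`) the collision series is free transport,
`f(t, x, v) = f₀(x - tv, v)` (sanity check of the normalisations). [folklore] -/
theorem lorentzSeriesSolution_of_coeff_zero (t : ℝ) (x : X) (v : EuclideanSpace ℝ d) :
    lorentzSeriesSolution G 0 f₀ t x v = f₀ (G.translate x ((-t) • v)) v := by
  rw [lorentzSeriesSolution_apply, tsum_eq_single 0]
  · simp
  · intro n hn
    obtain ⟨m, rfl⟩ := Nat.exists_eq_succ_of_ne_zero hn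
    exact lorentzSeriesTerm_succ_of_coeff_zero G f₀ m t x v

/-- The terms of the collision series are nonnegative for nonnegative data, `σ ≥ 0` and
`t ≥ 0` (each is an iterated integral of nonnegative integrands). [folklore] -/
theorem lorentzSeriesTerm_nonneg {σ : ℝ} (hσ : 0 ≤ σ) {f₀ : X → EuclideanSpace ℝ d → ℝ}
    (hf₀ : ∀ x v, 0 ≤ f₀ x v) (n : ℕ) {t : ℝ} (ht : 0 ≤ t) (x : X) (v : EuclideanSpace ℝ d) :
    0 ≤ lorentzSeriesTerm G σ f₀ n t x v := by
  induction n generalizing t x v with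
  | zero => exact mul_nonneg (exp_pos _).le (hf₀ _ _)
  | succ n ih =>
    rw [lorentzSeriesTerm_succ]
    refine intervalIntegral.integral_nonneg ht fun s hs => ?_
    exact mul_nonneg (exp_pos _).le
      (mul_nonneg hσ (lorentzGainOp_nonneg (fun w => ih hs.1 _ w) v))

/-- The collision series is nonnegative for nonnegative data, `σ ≥ 0` and `t ≥ 0`. [folklore] -/
theorem lorentzSeriesSolution_nonneg {σ : ℝ} (hσ : 0 ≤ σ) {f₀ : X → EuclideanSpace ℝ d → ℝ}
    (hf₀ : ∀ x v, 0 ≤ f₀ x v) {t : ℝ} (ht : 0 ≤ t) (x : X) (v : EuclideanSpace ℝ d) :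
    0 ≤ lorentzSeriesSolution G σ f₀ t x v :=
  tsum_nonneg fun n => lorentzSeriesTerm_nonneg G hσ hf₀ n ht x v

end Series

/-! ## Named fact F1: the collision series is a global mild solution -/

section Facts

variable {d : Type*} [Fintype d]

local notation "𝔼" => EuclideanSpace ℝ d

/-- **F1 (global mild solutions of the linear Lorentz–Boltzmann equation via the collision
series).** Let `σ ≥ 0` and let `f₀ ≥ 0` be continuous and bounded on `ℝ^d × ℝ^d`. Then the
collision series `f = ∑ₙ uₙ` (`Kinetic.lorentzSeriesSolution (Euclidean.geometry d) σ f₀`)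
satisfies `f(0) = f₀` and is, for every `T ≥ 0`, a mild solution on `[0, T]` of
`∂ₜ f + v·∇ₓ f = σ L f` on `ℝ^d` (`Kinetic.IsMildLinearLorentzSolutionOn`): the series converges
locally uniformly (`|uₙ(t, x, v)| ≤ ‖f₀‖_∞ (σ |S^{d-1}| |v| t e^{σ|S^{d-1}||v|t})ⁿ / n!`, speed is
preserved by the jumps), its sum is continuous and solves the gain/loss Duhamel formula, which
along characteristics is equivalent to the Duhamel formula for `L = L⁺ - ν`. This is the
analytic (semigroup) half of the Gallavotti–Spohn theorem: the one-time marginals of Spohn's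
random flight process solve the linear Boltzmann equation, whose generator is (4.2) of Spohn
CMP 60 (1978) Thm 3 (semigroup `U_t = e^{(L+C)t}` of §3; Gallavotti 1972; cf.
`Kinetic.existsUnique_mildLinearBoltzmann` for the tagged-particle analogue). Routine; to be
discharged by Picard/Dyson estimates. [cite: Spohn1978, §3 and Thm 3, (4.2)] -/
def lorentzSeries_isMildSolution : Prop :=
  ∀ {σ : ℝ} (_hσ : 0 ≤ σ) (f₀ : 𝔼 × 𝔼 → ℝ) (_hf₀ : Continuous f₀) (_hf₀0 : ∀ z, 0 ≤ f₀ z)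
    (_hf₀b : ∃ C, ∀ z, f₀ z ≤ C),
    ∀ T, 0 ≤ T → Literature.Analysis.FunctionSpaces.IsMildLinearLorentzSolutionOn T (Literature.Analysis.FluidPDE.Euclidean.geometry d) σ
      (lorentzSeriesSolution (Literature.Analysis.FluidPDE.Euclidean.geometry d) σ (Function.curry f₀))

end Facts

end Kinetic

/-! ## Named fact F3: Gallavotti's convergence of the annealed Lorentz gas to the series -/

section Hilbert6

variable {d : Type*} [Fintype d]

local notation "𝔼" => EuclideanSpace ℝ d

/-- **F3 (Gallavotti's theorem, annealed/observable form, limit identified with the collision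
series).** Let `d ≥ 2`, `σ > 0`, `ε_k → 0⁺`; for each `k` let `P k` be a Poisson point process
on `ℝ^d` of intensity `σ ε_k^{-(d-1)} dx` and `Λ k` a Lorentz flow among the balls of radius
`ε_k` centred at its points (`Kinetic.LorentzFlow`, an a.e. hypothesis structure). Then for every
continuous, bounded, integrable `f₀ ≥ 0`, every `t ≥ 0` and every bounded continuous `φ`,
`𝔼 ∫ φ(T^c_t z) f₀(z) dz ⟶ ∫ φ(z) f(t, z) dz` as `k → ∞`, where
`f = ∑ₙ uₙ = Kinetic.lorentzSeriesSolution (Euclidean.geometry d) σ f₀` is the collision series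
of `∂ₜ f + v·∇ₓ f = σ L f`. This is Thm. 2.1 of Bodineau–Gallagher–Saint-Raymond
(arXiv:1305.3397v2; after Gallavotti 1969/1972 and Spohn 1978), which prints the stronger
backward form "`f_ε(t) = 𝔼[f₀ ∘ T_ε^{-t}] → f(t)` in `L^∞([0, T]; L¹(ℝ^{2d}))`"; the forward form
follows by Liouville invariance of `T^c` on the Lorentz phase space
(`Kinetic.LorentzFlow.measurePreserving`) and the vanishing void-probability defect
`1 - e^{-σ|B^d|ε}` of the obstacle interiors, and the limit is identified with the collision
series as in Gallavotti's proof (Golse, *Recent results on the periodic Lorentz gas*, proof of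
Thm. 2.1: the recollision-free `n`-obstacle terms converge to `uₙ` by the tube/collision
change of variables `dc₁⋯dcₙ = ∏ ε^{d-1} (v_{i-1}·ωᵢ)₊ dωᵢ dtᵢ`, the recollision part has
vanishing mass). Together with `Kinetic.lorentzSeries_isMildSolution` it yields
`Hilbert6.gallavotti_spohn_lorentz` (`ShortRangePotentialsProofs`). The core of the theorem;
not yet discharged.
[cite: BodineauGallagherSaintRaymondInvent2016, Thm. 2.1 (after Gallavotti 1969; Spohn 1978)] -/
def gallavotti_lorentz_tendsto_series : Prop :=
  ∀ (_hd : 2 ≤ Fintype.card d) {σ : ℝ} (_hσ : 0 < σ) (ε : ℕ → ℝ) (_hε : ∀ k, 0 < ε k)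
    (_hε₀ : Tendsto ε atTop (𝓝 0)) (P : ℕ → Measure (Literature.Analysis.FunctionSpaces.PointConfig 𝔼))
    (_hP : ∀ k, Literature.Analysis.FunctionSpaces.IsPoissonPointProcess
      (ENNReal.ofReal (σ * (ε k ^ (Fintype.card d - 1))⁻¹) • (volume : Measure 𝔼)) (P k))
    (Λ : ∀ k, Literature.Analysis.FunctionSpaces.LorentzFlow (ε k) (P k)) (f₀ : 𝔼 × 𝔼 → ℝ) (_hf₀ : Continuous f₀)
    (_hf₀' : Integrable f₀) (_hf₀0 : ∀ z, 0 ≤ f₀ z) (_hf₀b : ∃ C, ∀ z, f₀ z ≤ C),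
    ∀ t, 0 ≤ t → ∀ φ : 𝔼 × 𝔼 → ℝ, Continuous φ → (∃ C, ∀ z, |φ z| ≤ C) →
      Tendsto (fun k => Literature.Analysis.FunctionSpaces.lorentzExpectation (Λ k) f₀ t φ) atTop
        (𝓝 (∫ z, φ z * KineticTheory.lorentzSeriesSolution (Literature.Analysis.FluidPDE.Euclidean.geometry d) σ
          (Function.curry f₀) t z.1 z.2))

end Hilbert6

end

end Literature.MathematicalPhysics.KineticTheory
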